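import Summits.Langlands.Langlands.Theorems.IrreducibilityBySelfDualityIrreducibleOffSectorRankTwoRegular
import Summits.Langlands.Langlands.Theorems.IrreducibilityBySelfDualityIrreducibleOffSectorIsobaricRigidityOfRank
import Literature.NumberTheory.Automorphic.PairLFunctionPolesRepDataHolds
import HarnessLib

/-!
# `IrreducibleOffSector` in rank two for ARBITRARY cuspidal `π`: `E`-rational avatars are irreducible
(crux stmt-Langlands-14329 `IrreducibilityBySelfDuality.IrreducibleOffSector`, line `Sketch`;
`--supports` file, STRUCTURAL: no import of the route module)

The rank-two regular child `isIrreducible_rank_two_of_isRegular` (p113499 / p115614) uses the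
regularity and L-algebraicity of `π` at exactly one point: to make every avatar `ρ` `E`-RATIONAL
(Frobenius characteristic polynomials over a number field `E` at almost all places) through Clozel's
Hecke field of the regular algebraic twist.  Everything after that — the two characters of a
reducible semisimple rank-two representation weakly divide it, Böckle–Hui's Thm. 1.1 (the text of the
route item `WeakAbelianSummandHecke`, a THEOREM of the tree) attaches cuspidal `GL(1)` data to them,
and Jacquet–Shalika's isobaric rigidity for `GL_2` versus `GL_1 ⊞ GL_1` (`isobaricRigidity_of_JS_of_rank`,
with Arthur–Clozel (2.3) in rank one being Hecke's theorem `JacquetShalika1981_partialPairL_pole_repData_one`)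
contradicts the cuspidality of `π` — needs NO hypothesis on `π_∞`.  This file records the resulting
sharper child:

* `isIrreducible_rank_two_of_rational` — for EVERY number field `K` and EVERY cuspidal `π` on
  `GL_2(𝔸_K)` (regular or not, algebraic or not), every `ρ : Γ_K → GL_2(ℚ̄_ℓ)` that is
  Satake–Frobenius compatible with `(π, ι)` at almost all places AND `E`-rational at almost all
  places, for some number field `E →+* ℚ̄_ℓ`, is irreducible — modulo Böckle–Hui Thm. 1.1 (tree
  theorem, taken as text) and Arthur–Clozel (2.2) only;
* `isIrreducible_rank_two_of_exists_rational` — hence if `π` admits ONE a.e.-compatible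
  `E`-rational avatar `ρ₀`, then EVERY a.e.-compatible `ρ` is irreducible (Chebotarev–Brauer–Nesbitt
  transfer, p79199).

So in rank two the open content of the crux is precisely the ARITHMETIC input "some (equivalently,
by Chebotarev, every semisimple) compatible avatar is `E`-rational": automatic for regular `π`
(Clozel 1990 Thm. 3.13, whence p113499), automatic for the finite-image representations of
Deligne–Serre / Rogawski–Tunnell attached to holomorphic weight-one forms, and open for irregular
`π` in general (Buzzard–Gee 2014, Conj. 3.1.6; cf. the ideator's wild-`ι` obstruction,
`Cruxes/IrreducibleOffSector/NOTES-r1-k2.md` §3, which shows that no analytic argument can replace it).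

References: G. Böckle, C.-Y. Hui, Math. Ann. 393 (2025), Thm. 1.1, §3.2.1; H. Jacquet, J. Shalika,
Amer. J. Math. 103 (1981) II, Thm. 4.4; K. Ribet, LNM 601 (1977), Thm. 2.3; P. Deligne, J.-P. Serre,
ASENS 7 (1974), §8–9; K. Buzzard, T. Gee, LMS LNS 414 (2014), Conj. 3.1.6.
-/

noncomputable section

set_option linter.dupNamespace false

open scoped NumberField Classical Polynomial
open Filter IsDedekindDomain Polynomial NumberField
open Literature.NumberTheory.Automorphic Literature.NumberTheory.GaloisRepresentations
open Summit.Langlands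

namespace Summit.Langlands.Langlands.Theorems.IrreducibleOffSector

/-- **In rank two, `E`-rational avatars of a cuspidal `π` are irreducible** (every number field `K`,
EVERY cuspidal `π` on `GL_2(𝔸_K)` — no archimedean hypothesis).  Grant Böckle–Hui 2025 Thm. 1.1 in
its cofinite `GL(1)` form (the text of the route item `WeakAbelianSummandHecke`, a theorem of the
tree) and Arthur–Clozel (2.2) for Borel–Jacquet data.  Let `ρ : Γ_K → GL_2(ℚ̄_ℓ)` be Satake–Frobenius
compatible with `(π, ι)` at almost all places and `E`-rational at almost all places (unramified with
Frobenius characteristic polynomial in the image of `E[X]`, `E` a number field, `e : E →+* ℚ̄_ℓ`).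
Then `ρ` is irreducible.  Proof: a continuous semisimplification `r` of `ρ` keeps compatibility,
`E`-rationality and reducibility; its two diagonal characters weakly divide it, so Böckle–Hui's
theorem attaches cuspidal `GL(1)` data `χ_A`, `χ_D` to them, and `t_{π,v} = {c_v} + {d_v}` at almost
all `v` contradicts isobaric rigidity for `GL_2` versus `GL_1 ⊞ GL_1` (Jacquet–Shalika II Thm. 4.4,
with (2.3) in rank one = Hecke). [cite: BockleHui2025, Theorem 1.1 and §3.2.1]
[cite: JacquetShalikaAJM1981II, Thm. 4.4] -/
theorem isIrreducible_rank_two_of_rational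
    (hWA : ∀ (K : Type) [Field K] [NumberField K] (h1 : isCompact_glFiniteIntegralLevel 1 K) (ℓ : ℕ) [Fact ℓ.Prime] (n : ℕ) (E : Type) [Field E] [NumberField E] (e : E →+* PadicAlgCl ℓ) (ρ : Literature.NumberTheory.GaloisRepresentations.FramedGaloisRep K (PadicAlgCl ℓ) n), ρ.toGaloisRep.IsSemisimple → (∀ᶠ v in cofinite, ρ.IsUnramifiedAt v ∧ ∃ P : Polynomial E, ρ.HasFrobCharpolyAt v (P.map e)) → ∀ (ψ : Literature.NumberTheory.GaloisRepresentations.FramedGaloisRep K (PadicAlgCl ℓ) 1), (∀ᶠ v in cofinite, ρ.IsUnramifiedAt v ∧ ψ.IsUnramifiedAt v ∧ ∀ 𝔓 ∈ v.primesAbove, ∀ σ : Field.absoluteGaloisGroup K, IsArithFrobAt (NumberField.RingOfIntegers K) σ 𝔓 → ψ.charpoly σ ∣ ρ.charpoly σ) → ∀ (ι : PadicAlgCl ℓ ≃+* ℂ), ∃ χ : Literature.NumberTheory.Automorphic.CuspidalAutomorphicRepData 1 K h1, χ.1.IsRegularAlgebraic ∧ ∀ᶠ v in cofinite, ∃ c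 : ℂ, χ.1.HasSatakeParamAt v {c} ∧ ψ.IsUnramifiedAt v ∧ ψ.HasFrobCharpolyAt v (Literature.NumberTheory.Automorphic.arithFrobPolyOfSatake ι v.residueCard 1 {c}))
    (h22 : JacquetShalika1981_partialPairL_boundary_repData)
    {K : Type} [Field K] [NumberField K] {hcpt : isCompact_glFiniteIntegralLevel 2 K}
    (π : CuspidalAutomorphicRepData 2 K hcpt)
    {ℓ : ℕ} [Fact ℓ.Prime] (ι : PadicAlgCl ℓ ≃+* ℂ) {E : Type} [Field E] [NumberField E]
    (e : E →+* PadicAlgCl ℓ) (ρ : FramedGaloisRep K (PadicAlgCl ℓ) 2)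
    (hρ : ∀ᶠ v : HeightOneSpectrum (𝓞 K) in cofinite, SatakeFrobCompatibleAt ι π.1 ρ v)
    (hrat : ∀ᶠ v : HeightOneSpectrum (𝓞 K) in cofinite,
      ρ.IsUnramifiedAt v ∧ ∃ P : Polynomial E, ρ.HasFrobCharpolyAt v (P.map e)) :
    ρ.toGaloisRep.IsIrreducible := by
  by_contra hρirr
  have h1 : isCompact_glFiniteIntegralLevel 1 K := isCompact_glFiniteIntegralLevel_holds 1 K
  -- a continuous semisimplification `r` of `ρ`: compatible, `E`-rational, reducible
  obtain ⟨r, hss, hrcp, hrker⟩ := IrreducibleGL3CM.stub_continuousSemisimplification K ℓ 2 ρ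
  have hr : ∀ᶠ v : HeightOneSpectrum (𝓞 K) in cofinite, SatakeFrobCompatibleAt ι π.1 r v :=
    eventually_satakeFrobCompatibleAt_of_charpoly_eq π.1 ι hrcp hrker hρ
  have hrrat : ∀ᶠ v : HeightOneSpectrum (𝓞 K) in cofinite,
      r.IsUnramifiedAt v ∧ ∃ P : Polynomial E, r.HasFrobCharpolyAt v (P.map e) := by
    filter_upwards [hrat] with v hv
    obtain ⟨hur, P, hP⟩ := hv
    exact ⟨fun 𝔓 h𝔓 σ hσ => hrker σ (hur 𝔓 h𝔓 σ hσ), P,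
      fun 𝔓 h𝔓 σ hσ => (hrcp σ).trans (hP 𝔓 h𝔓 σ hσ)⟩
  have hirr : ¬ r.toGaloisRep.IsIrreducible :=
    IrreducibleGL3CM.stub_not_isIrreducible_of_charpoly_eq K ℓ 2 ρ r hss hrcp hρirr
  -- the two characters of `r`
  obtain ⟨A, D, hcp, hur⟩ := exists_blocks_of_not_isIrreducible_two r hirr
  have hrunr : ∀ᶠ v : HeightOneSpectrum (𝓞 K) in cofinite, r.IsUnramifiedAt v :=
    hr.mono fun v hv => hv.choose_spec.2.1
  have hdivA : ∀ᶠ v : HeightOneSpectrum (𝓞 K) in cofinite, r.IsUnramifiedAt v ∧ A.IsUnramifiedAt v ∧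
      ∀ 𝔓 ∈ v.primesAbove, ∀ σ : Field.absoluteGaloisGroup K, IsArithFrobAt (𝓞 K) σ 𝔓 →
        A.charpoly σ ∣ r.charpoly σ :=
    hrunr.mono fun v hv => ⟨hv, (hur v hv).1, fun 𝔓 _ σ _ => ⟨D.charpoly σ, hcp σ⟩⟩
  have hdivD : ∀ᶠ v : HeightOneSpectrum (𝓞 K) in cofinite, r.IsUnramifiedAt v ∧ D.IsUnramifiedAt v ∧
      ∀ 𝔓 ∈ v.primesAbove, ∀ σ : Field.absoluteGaloisGroup K, IsArithFrobAt (𝓞 K) σ 𝔓 →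
        D.charpoly σ ∣ r.charpoly σ :=
    hrunr.mono fun v hv => ⟨hv, (hur v hv).2, fun 𝔓 _ σ _ => ⟨A.charpoly σ, by rw [hcp σ, mul_comm]⟩⟩
  -- Böckle–Hui Thm 1.1 in GL(1) form: both characters are attached to cuspidal GL(1) data
  obtain ⟨χA, -, hχA⟩ := hWA K h1 ℓ 2 E e r hss hrrat A hdivA ι
  obtain ⟨χD, -, hχD⟩ := hWA K h1 ℓ 2 E e r hss hrrat D hdivD ι
  -- isobaric rigidity for `GL₂` versus `GL₁ ⊞ GL₁`, (2.3) in rank one being Hecke's theorem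
  refine (isobaricRigidity_of_JS_of_rank h22 K 2 hcpt two_pos π 2 (fun _ => 1) (fun _ => h1)
    (fun _ τ τ' => JacquetShalika1981_partialPairL_pole_repData_one h1 τ τ')
    (fun i => ![χA, χD] i) le_rfl (fun _ => one_pos) ?_).elim
  filter_upwards [hr, hχA, hχD] with v hv hvA hvD
  intro α hα
  obtain ⟨α₀, hα₀, -, hcpv⟩ := hv
  obtain rfl : α = α₀ := AutomorphicRepData.hasSatakeParamAt_unique_holds π.1 hα hα₀
  obtain ⟨c, hc, -, hcpA⟩ := hvA
  obtain ⟨d, hd, -, hcpD⟩ := hvD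
  refine ⟨![{c}, {d}], Fin.forall_fin_two.2 ⟨hc, hd⟩, ?_⟩
  -- the Frobenius polynomial of `r` is the product of those of `A` and `D`
  have hprod : r.HasFrobCharpolyAt v
      (arithFrobPolyOfSatake ι v.residueCard 1 {c} * arithFrobPolyOfSatake ι v.residueCard 1 {d}) := by
    intro 𝔓 h𝔓 τ hτ
    rw [hcp τ, hcpA 𝔓 h𝔓 τ hτ, hcpD 𝔓 h𝔓 τ hτ]
  rw [← arithFrobPolyOfSatake_add] at hprod
  have heq : arithFrobPolyOfSatake ι v.residueCard 1 α =
      arithFrobPolyOfSatake ι v.residueCard 1 ({c} + {d}) :=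
    GaloisRep.HasFrobCharpolyAt.unique_holds
      ((FramedGaloisRep.hasFrobCharpolyAt_toGaloisRep_iff v _ r).mpr hcpv)
      ((FramedGaloisRep.hasFrobCharpolyAt_toGaloisRep_iff v _ r).mpr hprod)
  rw [arithFrobPolyOfSatake_one_injective ι _ heq, Fin.sum_univ_two]
  rfl

/-- **One `E`-rational avatar makes every avatar irreducible (rank two).**  Grant Böckle–Hui 2025
Thm. 1.1 (cofinite `GL(1)` form) and Arthur–Clozel (2.2).  If a cuspidal `π` on `GL_2(𝔸_K)` (any
number field `K`, no archimedean hypothesis) admits ONE `ρ₀ : Γ_K → GL_2(ℚ̄_ℓ)` that is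
Satake–Frobenius compatible with `(π, ι)` and `E`-rational at almost all places, then EVERY `ρ`
Satake–Frobenius compatible with `(π, ι)` at almost all places is irreducible: `ρ₀` is irreducible by
`isIrreducible_rank_two_of_rational`, and irreducibility transfers along common Frobenius polynomials
(Chebotarev + Brauer–Nesbitt, `isIrreducible_of_satakeFrobCompatible`, p79199).  This is the rank-two
slice of the crux reduced to the existence of an `E`-rational avatar — e.g. the finite-image
representation of a holomorphic weight-one form (Deligne–Serre 1974; Rogawski–Tunnell 1983).
[cite: BockleHui2025, Theorem 1.1 and §3.2.1] [cite: DeligneSerreASENS1974, Lemme 3.2] -/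
theorem isIrreducible_rank_two_of_exists_rational
    (hWA : ∀ (K : Type) [Field K] [NumberField K] (h1 : isCompact_glFiniteIntegralLevel 1 K) (ℓ : ℕ) [Fact ℓ.Prime] (n : ℕ) (E : Type) [Field E] [NumberField E] (e : E →+* PadicAlgCl ℓ) (ρ : Literature.NumberTheory.GaloisRepresentations.FramedGaloisRep K (PadicAlgCl ℓ) n), ρ.toGaloisRep.IsSemisimple → (∀ᶠ v in cofinite, ρ.IsUnramifiedAt v ∧ ∃ P : Polynomial E, ρ.HasFrobCharpolyAt v (P.map e)) → ∀ (ψ : Literature.NumberTheory.GaloisRepresentations.FramedGaloisRep K (PadicAlgCl ℓ) 1), (∀ᶠ v in cofinite, ρ.IsUnramifiedAt v ∧ ψ.IsUnramifiedAt v ∧ ∀ 𝔓 ∈ v.primesAbove, ∀ σ : Field.absoluteGaloisGroup K, IsArithFrobAt (NumberField.RingOfIntegers K) σ 𝔓 → ψ.charpoly σ ∣ ρ.charpoly σ) → ∀ (ι : PadicAlgCl ℓ ≃+* ℂ), ∃ χ : Literature.NumberTheory.Automorphic.CuspidalAutomorphicRepData 1 K h1, χ.1.IsRegularAlgebraic ∧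 ∀ᶠ v in cofinite, ∃ c : ℂ, χ.1.HasSatakeParamAt v {c} ∧ ψ.IsUnramifiedAt v ∧ ψ.HasFrobCharpolyAt v (Literature.NumberTheory.Automorphic.arithFrobPolyOfSatake ι v.residueCard 1 {c}))
    (h22 : JacquetShalika1981_partialPairL_boundary_repData)
    {K : Type} [Field K] [NumberField K] {hcpt : isCompact_glFiniteIntegralLevel 2 K}
    (π : CuspidalAutomorphicRepData 2 K hcpt)
    {ℓ : ℕ} [Fact ℓ.Prime] (ι : PadicAlgCl ℓ ≃+* ℂ) {E : Type} [Field E] [NumberField E]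
    (e : E →+* PadicAlgCl ℓ) {ρ₀ : FramedGaloisRep K (PadicAlgCl ℓ) 2}
    (hρ₀ : ∀ᶠ v : HeightOneSpectrum (𝓞 K) in cofinite, SatakeFrobCompatibleAt ι π.1 ρ₀ v)
    (hrat₀ : ∀ᶠ v : HeightOneSpectrum (𝓞 K) in cofinite,
      ρ₀.IsUnramifiedAt v ∧ ∃ P : Polynomial E, ρ₀.HasFrobCharpolyAt v (P.map e))
    (ρ : FramedGaloisRep K (PadicAlgCl ℓ) 2)
    (hρ : ∀ᶠ v : HeightOneSpectrum (𝓞 K) in cofinite, SatakeFrobCompatibleAt ι π.1 ρ v) :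
    ρ.toGaloisRep.IsIrreducible :=
  isIrreducible_of_satakeFrobCompatible π.1 ι
    (isIrreducible_rank_two_of_rational hWA h22 π ι e ρ₀ hρ₀ hrat₀) hρ₀ hρ

end Summit.Langlands.Langlands.Theorems.IrreducibleOffSector

end
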